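import Literature.NumberTheory.EllipticCurves.TwistedThreeKernelImage
import HarnessLib

/-!
# The twisted `3`-isogeny descent, transport form: the kernel point of `E/ℚ` read off a `μ₃`-kernel datum over the
# Kummer field `L`, and «`Ш(E/ℚ) ∩ ker φ_* = 0` from the `L`-box» with the Galois compatibilities DISCHARGED
# (Silverman X.4.2 (a); Cohen–Pazuki 2009, Prop. 1.4 (2), Prop. 2.2)

Topic `NumberTheory/EllipticCurves`. Sequel of `TwistedThreeKernelImage`. There, `eq_zero_of_mem_sha_of_galH1Map_eq_zero_of_twisted_box`
takes the twist `ψ` and three compatibilities (`ψ ∘ res = ε_L`, `ψ(σ̃^{±1}) = 1`, `Φ(T) = 𝒯.T`) as hypotheses. Here they are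
PRODUCED: start from a `μ₃`-kernel datum `𝒯` on `E_L` (`MuThreeTorsorClass`) and let `T ∈ E(ℚ̄)` be the transport of `𝒯.T` along
`Φ = localPointsEquivGeomPoints ∘ pointsMap : E(ℚ̄) ≃ E_L(L̄)` (a `res`-equivariant additive bijection). Then

* §1 `exists_geomPoint_transport` (`T` exists), and for such `T`: `T ≠ O`, `T + T = −T`, `(res τ) • T = ε(τ) T`
  (`transport_ne_zero`, `transport_add_self`, `resGal_smul_transport`) — no coordinates;
* §2 for a `Γ_ℚ`-equivariant surjection `f` with `f T = O` and `ker f ⊆ {O, ±T}`: `σ • T = ±T`, so the twist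
  `ψ(σ) ∈ {1, −1} ⊂ ℤ/3` is DEFINED by `σ • T = ψ(σ) T` (`exists_twist`), and `ψ ∘ res = ε_L`;
* §3 if the lift `c̄` fixes the COORDINATES of `𝒯.T` (for the Mordell datum `(0, (λ/3)√−3)` with `c λ = −λ`: `c̄` negates both
  `λ` and `√−3`), then `σ̃ • T = T` (`sigmaTilde_smul_transport`), whence `ψ(σ̃) = ψ(σ̃⁻¹) = 1`;
* §4 ★★ `eq_zero_of_mem_sha_of_galH1Map_eq_zero_of_box_transport` — «sharp norm-cube `L`-box ⇒ `Ш(E/ℚ) ∩ ker f_* = 0`» with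
  only STRUCTURAL hypotheses left: (`L`, `c`, `c̄`) as in `TwistedKummerCharacterNorm`, `𝒯`, `c̄` fixes the coordinates of `𝒯.T`,
  `f` equivariant surjective with `f T = O`, `ker f ⊆ {O, ±T}` for the transported `T`.

What is NOT here: the Vélu isogeny of `y² = x³ + k` over `ℚ` itself (consumers supply `f`; for a RATIONAL `s = √k` it is the tree's
`IsVeluThreePair.geomHom`), the boxes, the `φ̂`-side. Everything here is proved; no definitions, no named facts.

## References

* [SilvermanAEC2009] J. H. Silverman, *AEC*, Thm. X.4.2 (a), App. B §2 (restriction), X.§4.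
* [CohenPazuki2009] H. Cohen, F. Pazuki, Acta Arith. 140 (2009), Proposition 1.4 (2), Proposition 2.2.
* Tree: `TwistedThreeKernelImage`, `TwistedKummerCharacterNorm`, `MuThreeTorsorClass`, `Sha`/`ShaRestriction`
  (`pointsMap`, `pointsMap_smul`, `pointsMapOfEmb_bijective`, `localPointsEquivGeomPoints(_smul)`), `MordellCurveThreeDescent(Local)`
  (`smul_geomPoints_some`, `nonsingular_galAut`, `pointsMap_some`, `iotaE_galAut_resGal`).
-/

noncomputable section

open scoped Classical

namespace Literature.NumberTheory.EllipticCurves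

namespace TwistedKummer

open _root_.WeierstrassCurve GaloisRepresentations MordellDescent CPMuDescent

/-! ## §1 The transported kernel point -/

section Transport

variable {L : Type} [Field L] [NumberField L] {E : WeierstrassCurve ℚ} (𝒯 : MuThreeKernel (E.baseChange L))

/-- The composite `Φ = localPointsEquivGeomPoints ∘ pointsMap : E(ℚ̄) → E_L(L̄)` is injective. [cite: SilvermanAEC2009, App. B §2] -/
theorem transportMap_injective :
    Function.Injective fun P : geomPoints E => localPointsEquivGeomPoints E L (pointsMap E L P) := by
  intro P Q h
  have h1 := (localPointsEquivGeomPoints E L).injective h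
  exact pointsMapOfEmb_injective E (iotaE (K := ℚ) L) h1

/-- **A geometric point `T ∈ E(ℚ̄)` transporting to `𝒯.T ∈ E_L(L̄)` exists** (`Φ` is onto for `L/ℚ` algebraic).
[cite: SilvermanAEC2009, App. B §2] -/
theorem exists_geomPoint_transport :
    ∃ T : geomPoints E, localPointsEquivGeomPoints E L (pointsMap E L T) = 𝒯.T := by
  obtain ⟨P, hP⟩ := (pointsMapOfEmb_bijective L E (iotaE (K := ℚ) L)).2 ((localPointsEquivGeomPoints E L).symm 𝒯.T)
  exact ⟨P, by change localPointsEquivGeomPoints E L (pointsMapOfEmb E (iotaE (K := ℚ) L) P) = _; rw [hP, AddEquiv.apply_symm_apply]⟩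

variable {𝒯} {T : geomPoints E} (hT : localPointsEquivGeomPoints E L (pointsMap E L T) = 𝒯.T)
include hT

/-- The transported point is non-zero. [cite: SilvermanAEC2009, Thm. X.4.2 (a)] -/
theorem transport_ne_zero : T ≠ 0 := by
  intro h0
  apply 𝒯.T_ne_zero
  rw [← hT, h0, map_zero, map_zero]

/-- The transported point has order `3`: `T + T = −T`. [cite: SilvermanAEC2009, Thm. X.4.2 (a)] -/
theorem transport_add_self : T + T = -T := by
  apply transportMap_injective (E := E) (L := L)
  simp only [map_add, map_neg, hT]
  exact 𝒯.T_add_T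

/-- **`Γ_L` acts on the transported point through the cyclotomic sign**: `(res τ) • T = ε(τ) T` (as `τ • 𝒯.T = ε(τ) 𝒯.T`
and `Φ` is `res`-equivariant). [cite: SilvermanAEC2009, Thm. X.4.2 (a)] -/
theorem resGal_smul_transport (τ : Field.absoluteGaloisGroup L) : resGal (K := ℚ) L τ • T = epsNat τ • T := by
  apply transportMap_injective (E := E) (L := L)
  simp only [map_nsmul]
  rw [pointsMap_smul, localPointsEquivGeomPoints_smul, hT]
  exact 𝒯.smul_T_eq_epsNat_nsmul τ

end Transport

/-! ## §2 The twist `ψ` from an equivariant surjection with kernel `{O, ±T}` -/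

section Twist

variable {K : Type*} [Field K] {W W' : WeierstrassCurve K} {T : geomPoints W} (hT0 : T ≠ 0) (hTT : T + T = -T)
  (f : geomPoints W →+ geomPoints W')
  (hf : ∀ (σ : Field.absoluteGaloisGroup K) (P : geomPoints W), f (σ • P) = σ • f P)
  (hfT : f T = 0) (hker : ∀ P : geomPoints W, f P = 0 → P = 0 ∨ P = T ∨ P = -T)
include hT0 hf hfT hker

/-- `σ • T = T` or `σ • T = −T`: `σT` lies in the Galois-stable kernel and is non-zero. [cite: SilvermanAEC2009, Thm. X.4.2 (a)] -/
theorem smul_eq_or_eq_neg (σ : Field.absoluteGaloisGroup K) : σ • T = T ∨ σ • T = -T := by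
  have h0 : f (σ • T) = 0 := by rw [hf, hfT, smul_zero]
  rcases hker _ h0 with h | h | h
  · exfalso; apply hT0
    have : σ⁻¹ • (σ • T) = σ⁻¹ • (0 : geomPoints W) := by rw [h]
    rwa [inv_smul_smul, smul_zero] at this
  · exact Or.inl h
  · exact Or.inr h

include hTT in
/-- **The twist exists**: a function `ψ : Γ_K → ℤ/3ℤ` (values `±1`) with `σ • T = ψ(σ) T`. [cite: SilvermanAEC2009, Thm. X.4.2 (a)] -/
theorem exists_twist : ∃ ψ : Field.absoluteGaloisGroup K → ZMod 3,
    (∀ σ, σ • T = (ψ σ).val • T) ∧ (∀ σ, ψ σ = 1 ∨ ψ σ = -1) ∧ ∀ σ, (ψ σ = 1 ↔ σ • T = T) := by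
  have hTneg : T ≠ -T := by
    intro h
    apply hT0
    have h2 : T + T = T := by rw [hTT]; exact h.symm
    simpa using h2
  refine ⟨fun σ => if σ • T = T then 1 else -1, fun σ => ?_, fun σ => ?_, fun σ => ?_⟩
  · dsimp only
    by_cases h : σ • T = T
    · rw [if_pos h, ZMod.val_one, one_nsmul, h]
    · rw [if_neg h, show ((-1 : ZMod 3)).val = 2 from rfl, two_nsmul, hTT]
      exact (smul_eq_or_eq_neg hT0 f hf hfT hker σ).resolve_left h
  · dsimp only
    by_cases h : σ • T = T
    · exact Or.inl (if_pos h)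
    · exact Or.inr (if_neg h)
  · dsimp only
    by_cases h : σ • T = T
    · rw [if_pos h]; simp [h]
    · rw [if_neg h]; simp only [h, iff_false]; decide

end Twist

/-! ## §3 The compatibilities of the twist of a transported point -/

section Compat

variable {L : Type} [Field L] [NumberField L] {E E' : WeierstrassCurve ℚ} {𝒯 : MuThreeKernel (E.baseChange L)}
  {T : geomPoints E} (hT : localPointsEquivGeomPoints E L (pointsMap E L T) = 𝒯.T)
  {ψ : Field.absoluteGaloisGroup ℚ → ZMod 3} (hψval : ∀ σ, ψ σ = 1 ∨ ψ σ = -1) (hψiff : ∀ σ, ψ σ = 1 ↔ σ • T = T)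
include hT hψval hψiff

/-- **`ψ ∘ res = ε_L`** for the twist of a transported point. [cite: SilvermanAEC2009, Thm. X.4.2 (a)] -/
theorem twist_resGal (τ : Field.absoluteGaloisGroup L) : ψ (resGal (K := ℚ) L τ) = eps τ := by
  have hT0 := transport_ne_zero hT
  have hTT := transport_add_self hT
  have hTneg : T ≠ -T := by
    intro h; apply hT0
    have h2 : T + T = T := by rw [hTT]; exact h.symm
    simpa using h2
  have hres := resGal_smul_transport hT τ
  unfold eps epsNat at *
  split_ifs at hres ⊢ with h
  · rw [one_nsmul] at hres
    exact (hψiff _).mpr hres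
  · rw [two_nsmul, hTT] at hres
    have hne : ¬ resGal (K := ℚ) L τ • T = T := by rw [hres]; exact fun e => hTneg e.symm
    rcases hψval (resGal (K := ℚ) L τ) with h1 | h1
    · exact absurd ((hψiff _).mp h1) hne
    · exact h1

variable (cbar : AlgebraicClosure L ≃+* AlgebraicClosure L)

omit hψval hψiff in
/-- **`σ̃ • T = T`** when `c̄` fixes the coordinates of `𝒯.T` (`σ̃ = ι⁻¹ c̄ ι` acts on the coordinates of `T` through `c̄`).
[cite: CohenPazuki2009, Definition 1.3 (G₃)] -/
theorem sigmaTilde_smul_transport {x₀ y₀ : AlgebraicClosure L}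
    {h₀ : ((E.baseChange L).baseChange (AlgebraicClosure L)).toAffine.Nonsingular x₀ y₀}
    (hTc : 𝒯.T = Affine.Point.some x₀ y₀ h₀) (hx : cbar x₀ = x₀) (hy : cbar y₀ = y₀) :
    sigmaTilde cbar • T = T := by
  have hT0 := transport_ne_zero hT
  have hinj : Function.Injective (pointsMap E L) := pointsMapOfEmb_injective E (iotaE (K := ℚ) L)
  revert hT
  rcases T with _ | ⟨x, y, hxy⟩
  · exact absurd rfl hT0
  · intro hT
    -- coordinates of `Φ(T)`: `(ι x, ι y) = (x₀, y₀)`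
    have e := hT
    change Affine.Point.congrEquiv (baseChange_baseChange E L (AlgebraicClosure L)).symm
      (Affine.Point.map (iotaE (K := ℚ) L) (Affine.Point.some x y hxy)) = _ at e
    rw [Affine.Point.map_some, Affine.Point.congrEquiv_some, hTc] at e
    simp only [Affine.Point.some.injEq] at e
    obtain ⟨ex, ey⟩ := e
    apply hinj
    change pointsMap E L (sigmaTilde cbar • (show geomPoints E from Affine.Point.some x y hxy)) =
      pointsMap E L (show geomPoints E from Affine.Point.some x y hxy)
    rw [smul_geomPoints_some (sigmaTilde cbar) hxy (nonsingular_galAut _ hxy)]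
    change Affine.Point.map (iotaE (K := ℚ) L) _ = Affine.Point.map (iotaE (K := ℚ) L) _
    rw [Affine.Point.map_some, Affine.Point.map_some]
    exact point_some_ext (by rw [iotaE_sigmaTilde, ex, hx]) (by rw [iotaE_sigmaTilde, ey, hy])

end Compat

/-! ## §4 `Ш(E/ℚ) ∩ ker f_* = 0` from the `L`-box, structural hypotheses only -/

section Final

variable {L : Type} [Field L] [NumberField L] [IsGalois ℚ L] (c : L ≃+* L) (hc2 : ∀ x : L, c (c x) = x)
  (cbar : AlgebraicClosure L ≃+* AlgebraicClosure L)
  (hcbar : ∀ x : L, cbar (algebraMap L (AlgebraicClosure L) x) = algebraMap L (AlgebraicClosure L) (c x))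
  (hθ : cbar (theta L) = -theta L)
include hc2 hcbar hθ

/-- ★★ **`Ш(E/ℚ) ∩ ker f_* = 0` from the sharp norm-cube box over `L`, transport form.** Data: `L` Galois over `ℚ` of degree
prime to `3`, `√−3 ∉ L`, an involution `c` with a lift `c̄` negating `√−3`; `𝒯` a `μ₃`-kernel datum on `E_L` whose point has
`c̄`-FIXED coordinates; `T ∈ E(ℚ̄)` its transport; `f : E(ℚ̄) → E'(ℚ̄)` a `Γ_ℚ`-equivariant surjection with `f T = O` and
`ker f ⊆ {O, ±T}`. If every `[C_u] ∈ Ш(E_L/L)` with `u · c(u)` a `c`-fixed non-zero cube vanishes, then every `c₀ ∈ Ш(E/ℚ)` killed by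
`f_*` is `0`. [cite: CohenPazuki2009, Proposition 1.4 (2) and Proposition 2.2] [cite: SilvermanAEC2009, Thm. X.4.2 (a)] -/
theorem eq_zero_of_mem_sha_of_galH1Map_eq_zero_of_box_transport (hL : ∀ q : L, q ^ 2 ≠ -3)
    (hdeg : Nat.Coprime 3 (Module.finrank ℚ L)) {E E' : WeierstrassCurve ℚ} (𝒯 : MuThreeKernel (E.baseChange L))
    {T : geomPoints E} (hT : localPointsEquivGeomPoints E L (pointsMap E L T) = 𝒯.T)
    {x₀ y₀ : AlgebraicClosure L} {h₀ : ((E.baseChange L).baseChange (AlgebraicClosure L)).toAffine.Nonsingular x₀ y₀}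
    (hTc : 𝒯.T = Affine.Point.some x₀ y₀ h₀) (hx : cbar x₀ = x₀) (hy : cbar y₀ = y₀)
    (f : geomPoints E →+ geomPoints E')
    (hf : ∀ (σ : Field.absoluteGaloisGroup ℚ) (P : geomPoints E), f (σ • P) = σ • f P)
    (hsurj : Function.Surjective f) (hfT : f T = 0) (hker : ∀ P : geomPoints E, f P = 0 → P = 0 ∨ P = T ∨ P = -T)
    (hbox : ∀ {u : L} (hu : u ≠ 0), (∃ r : L, c r = r ∧ r ≠ 0 ∧ u * c u = r ^ 3) →
      𝒯.torsorClass hu ∈ (E.baseChange L).sha → 𝒯.torsorClass hu = 0)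
    {c₀ : E.galH1} (hc₀ : c₀ ∈ E.sha) (h0 : galH1Map f hf c₀ = 0) : c₀ = 0 := by
  have hT0 := transport_ne_zero hT
  have hTT := transport_add_self hT
  obtain ⟨ψ, hψT, hψval, hψiff⟩ := exists_twist hT0 hTT f hf hfT hker
  have hψres : ∀ τ : Field.absoluteGaloisGroup L, ψ (resGal (K := ℚ) L τ) = eps τ :=
    fun τ => twist_resGal hT hψval hψiff τ
  have hfix : sigmaTilde cbar • T = T := sigmaTilde_smul_transport hT cbar hTc hx hy
  have hψ1 : ψ (sigmaTilde cbar) = 1 := (hψiff _).mpr hfix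
  have hψ2 : ψ (sigmaTilde cbar)⁻¹ = 1 := (hψiff _).mpr (by
    conv_lhs => rw [← hfix]
    rw [inv_smul_smul])
  exact eq_zero_of_mem_sha_of_galH1Map_eq_zero_of_twisted_box c hc2 cbar hcbar hθ hL hdeg T hT0 hTT ψ hψT hψres hψ1 hψ2
    f hf hsurj hker 𝒯 hT hbox hc₀ h0

end Final

end TwistedKummer

end Literature.NumberTheory.EllipticCurves

end
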